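import Summits.Ventures.PackingBounds.Configurations.LeechSections
import Summits.Ventures.PackingBounds.SphericalCodes.TouchingMutuallyTouchingSpheresExists

/-!
# Leech contact codes at `cos θ = 1/3`: `A(22, arccos 1/3) ≥ 2816` and `A(21, arccos 1/3) ≥ 1792`

Framing: lottery ticket; floor = certified bounds/negative ranges. Venture `PackingBounds` (cell `pub-packcert`,
seat `pub-packcert-sdp`), the ATTAINED side of the B2c cells `(22, 1/3)` and `(21, 1/3)` (certified upper bounds
`A(22, arccos 1/3) ≤ 3313` and `A(21, arccos 1/3) ≤ 2550`, three-point SDP at `(14, 28)`, exact rational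
certificates — not kernel theorems).

Everything is counted STRUCTURALLY, exactly as in `LeechCard4600.lean` / `LeechSectionCount.lean` (the only kernel
enumerations are over the `4096` Golay messages, the `759` octads, the `128` sign patterns and the `1104` shape-`A`
indices; no list of vectors, no pair enumeration): among the `4600` neighbours `y` (`x₀·y = 16`) of the Leech
minimal vector `x₀ = (4,4,0²²)` (`√8`-scaling, `LeechCard4600.nbr`),

* the `y` with `x₀₂·y = 8` for the neighbour `x₀₂ = (4,0,4,0²¹)` of `x₀` — in coordinates `y₀ + y₁ = 4 ∧ y₀ + y₂ = 2` —
  are `0 + 56·32 + 2·512 = 2816` (`card_third22`): shape `B` on the `77 - 21 = 56` octads through `0, 1` avoiding `2`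
  with both signs `+` there, and shape `C` with `(y₀, y₁, y₂) = (3, 1, -1)` or `(1, 3, 1)`;
* those with moreover `x₁₂·y = 8` for `x₁₂ = (0,4,4,0²¹)` — `y₁ + y₂ = 2` — are the `1792` shape-`B` ones (`card_third21`).

The doubled projections `2y - x₀` (`LeechCard4600.proj`, norm `96`) of the `4600` neighbours have pairwise inner
products `4 y·y' - 32 ≤ 32`, i.e. cosines `≤ 1/3` (`inner_pre4600`, from `ip_le_of_mem`: two minimal vectors of the
Leech lattice have `y·y' ≤ 16`), and are orthogonal to `x₀`; on the first subfamily they are also orthogonal to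
`w₂₂ = (4,-4,8,0²¹)` (so they lie in the `22`-space `⟨x₀, x₀₂⟩^⊥`), on the second also to `(-4,4,4,0²¹)` (the `21`-space
`⟨x₀, x₀₂, x₁₂⟩^⊥`). `SubspaceTransfer.exists_transfer_orthogonal` moves them to `ℝ²²`, `ℝ²¹`:
**`A(22, arccos 1/3) ≥ 2816`** (`exists_code_dim22_third_2816`) and **`A(21, arccos 1/3) ≥ 1792`**
(`exists_code_dim21_third_1792`) — the minimal vectors of the Leech lattice at `60°` from `x₀` and at inner product `1`
(unscaled) with one, resp. two, further minimal vectors of the face `x₀, x₀₂, x₁₂` of the contact polytope. Inside the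
`(23, 4600, 1/3)` code these are the code points ORTHOGONAL to one code point (`A₀(u) = 2816` in the distance
distribution of SPLAG Ch. 14 Theorem 24 (e): `A_{1/3}(u) = A_{-1/3}(u) = 891`, `A₀(u) = 2816`), resp. to two code points
at inner product `1/3` — equatorial sub-codes, so no re-normalisation is needed. In the language of spheres
(`SphericalCodes.exists_touching_of_code`, `k = 1`): two touching unit spheres of `ℝ²³` (`ℝ²²`) are simultaneously
touched by at least `2816` (`1792`) unit spheres with pairwise disjoint interiors. These two sections continue
Conway–Sloane's list `(24, 196560, 1/2), (23, 4600, 1/3), (22, 891, 1/4), (21, 336, 1/5), …` of Leech codes sideways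
(same angle, lower dimension); no comparison value in print was found for the two cells (presearch: corpus +
galaxy, `2816` / `1792` with 'spherical code').

## References
* J. H. Conway, N. J. A. Sloane, *Sphere Packings, Lattices and Groups*, 3rd ed., Ch. 4 §11 (the minimal vectors
  (135)), Ch. 14 Theorem 1, Example 3 and Theorem 24 (e) (p. 450). [`ConwaySloane1999`]
* H. Cohn, A. Kumar, J. Amer. Math. Soc. 20 (2007) 99–148, Table 1 (row `(23, 4600)`). [`CohnKumar2006`]
-/

namespace Summit.Ventures.PackingBounds.Config.Leech

open Finset Golay

/-! ### The two sub-configurations of the `4600` neighbours of `x₀` -/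

/-- The neighbours `y` of `x₀ = (4,4,0,…)` (`y₀ + y₁ = 4`) with `x₀₂·y = 8` for `x₀₂ = (4,0,4,0,…)` (`y₀ + y₂ = 2`):
the `(22, 2816, 1/3)` Leech section. -/
noncomputable def third22 : Finset (Fin 24 → ℤ) := leechInt.filter fun y => y 0 + y 1 = 4 ∧ y 0 + y 2 = 2

/-- … and with `x₁₂·y = 8` for `x₁₂ = (0,4,4,0,…)` (`y₁ + y₂ = 2`): the `(21, 1792, 1/3)` Leech section. -/
noncomputable def third21 : Finset (Fin 24 → ℤ) :=
  leechInt.filter fun y => y 0 + y 1 = 4 ∧ y 0 + y 2 = 2 ∧ y 1 + y 2 = 2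

/-! ### Shape `C`: `(y₀, y₁, y₂) = (3, 1, -1)` or `(1, 3, 1)` -/

/-- The `22`-condition on shape `C`, in message bits. -/
theorem third22_cvec_iff (i : Fin 24) {u : ℕ} (hu : u < 4096) :
    ((cvec i u) 0 + (cvec i u) 1 = 4 ∧ (cvec i u) 0 + (cvec i u) 2 = 2) ↔
      (i = 0 ∧ u.testBit 0 = true ∧ u.testBit 1 = false ∧ u.testBit 2 = true) ∨
      (i = 1 ∧ u.testBit 0 = false ∧ u.testBit 1 = true ∧ u.testBit 2 = false) := by
  by_cases h0 : i = 0
  · subst h0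
    rw [cvec_apply_self (by decide) hu, cvec_apply_ne (by decide) (by decide) hu,
      cvec_apply_ne (by decide) (by decide) hu]
    simp only [Fin.val_zero, Fin.val_one, Fin.val_two, true_and]
    cases u.testBit 0 <;> cases u.testBit 1 <;> cases u.testBit 2 <;> simp
  by_cases h1 : i = 1
  · subst h1
    rw [cvec_apply_self (by decide) hu, cvec_apply_ne (by decide) (by decide) hu,
      cvec_apply_ne (by decide) (by decide) hu]
    simp only [Fin.val_zero, Fin.val_one, Fin.val_two, true_and]
    cases u.testBit 0 <;> cases u.testBit 1 <;> cases u.testBit 2 <;> simp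
  simp only [h0, h1, false_and, or_self, iff_false, not_and]
  intro h01
  exfalso
  rcases cvec_apply_cases i u 0 with ⟨-, e0 | e0⟩ | ⟨e, -⟩
  · rcases cvec_apply_cases i u 1 with ⟨-, e1 | e1⟩ | ⟨e, -⟩
    · omega
    · omega
    · exact h1 e.symm
  · rcases cvec_apply_cases i u 1 with ⟨-, e1 | e1⟩ | ⟨e, -⟩
    · omega
    · omega
    · exact h1 e.symm
  · exact h0 e.symm

/-- The `21`-condition fails on shape `C` (`y₁ + y₂ ∈ {0, 4}` there). -/
theorem not_third21_cvec (i : Fin 24) {u : ℕ} (hu : u < 4096) :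
    ¬ ((cvec i u) 0 + (cvec i u) 1 = 4 ∧ (cvec i u) 0 + (cvec i u) 2 = 2 ∧ (cvec i u) 1 + (cvec i u) 2 = 2) := by
  rintro ⟨h01, h02, h12⟩
  rcases (third22_cvec_iff i hu).mp ⟨h01, h02⟩ with ⟨rfl, hb0, hb1, hb2⟩ | ⟨rfl, hb0, hb1, hb2⟩
  · rw [cvec_apply_ne (by decide) (by decide) hu, cvec_apply_ne (by decide) (by decide) hu] at h12
    simp only [Fin.val_one, Fin.val_two, hb1, hb2, sgn_false, sgn_true] at h12
    omega
  · rw [cvec_apply_self (by decide) hu, cvec_apply_ne (by decide) (by decide) hu] at h12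
    simp only [Fin.val_one, Fin.val_two, hb1, hb2, sgn_false, sgn_true] at h12
    omega

set_option maxRecDepth 100000 in
/-- `2 · 512 = 1024` shape-`C` vectors satisfy the `22`-condition; none the `21`-condition. -/
theorem card_thirdC :
    ((univ ×ˢ range 4096).filter fun p : Fin 24 × ℕ =>
      (cvec p.1 p.2) 0 + (cvec p.1 p.2) 1 = 4 ∧ (cvec p.1 p.2) 0 + (cvec p.1 p.2) 2 = 2).card = 1024 ∧
    ((univ ×ˢ range 4096).filter fun p : Fin 24 × ℕ =>
      (cvec p.1 p.2) 0 + (cvec p.1 p.2) 1 = 4 ∧ (cvec p.1 p.2) 0 + (cvec p.1 p.2) 2 = 2 ∧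
        (cvec p.1 p.2) 1 + (cvec p.1 p.2) 2 = 2).card = 0 := by
  refine ⟨?_, ?_⟩
  · rw [Finset.filter_congr (q := fun p : Fin 24 × ℕ =>
        (p.1 = 0 ∧ p.2.testBit 0 = true ∧ p.2.testBit 1 = false ∧ p.2.testBit 2 = true) ∨
        (p.1 = 1 ∧ p.2.testBit 0 = false ∧ p.2.testBit 1 = true ∧ p.2.testBit 2 = false))
        (fun p hp => third22_cvec_iff p.1 (by simpa using hp))]
    decide +kernel
  · rw [Finset.card_eq_zero, Finset.filter_eq_empty_iff]
    intro p hp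
    exact not_third21_cvec p.1 (by simpa using hp)

/-! ### Shape `B`: octads through `0, 1` avoiding `2`, signs `+, +` -/

/-- The `22`-condition on shape `B`: the octad contains `0, 1` but not `2`, and the first two signs are `+`. -/
theorem third22_bvec_iff (o : Fin 759) (v : ℕ) :
    ((bvec o v) 0 + (bvec o v) 1 = 4 ∧ (bvec o v) 0 + (bvec o v) 2 = 2) ↔
      ((0 : Fin 24) ∈ osupp o ∧ (1 : Fin 24) ∈ osupp o ∧ (2 : Fin 24) ∉ osupp o) ∧
        (v.testBit 0 = false ∧ v.testBit 1 = false) := by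
  constructor
  · rintro ⟨h01, h02⟩
    rcases bvec_apply_cases o v 0 with ⟨h0, e0⟩ | ⟨h0, e0 | e0⟩ <;>
      rcases bvec_apply_cases o v 1 with ⟨h1, e1⟩ | ⟨h1, e1 | e1⟩ <;> (try omega)
    have h2 : (2 : Fin 24) ∉ osupp o := by
      rcases bvec_apply_cases o v 2 with ⟨h2, -⟩ | ⟨-, e2 | e2⟩
      · exact h2
      · omega
      · omega
    have hx := (bvec_nbr_iff o v).mp (by rw [ip_x0]; omega)
    exact ⟨⟨h0, h1, h2⟩, hx.2⟩
  · rintro ⟨⟨h0, h1, h2⟩, hv0, hv1⟩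
    have hx := (bvec_nbr_iff o v).mpr ⟨⟨h0, h1⟩, hv0, hv1⟩
    rw [ip_x0] at hx
    rw [(bvec_eq_zero_iff o v 2).mpr h2, add_zero]
    rcases bvec_apply_cases o v 0 with ⟨h0', -⟩ | ⟨-, e0 | e0⟩
    · exact absurd h0 h0'
    · constructor <;> omega
    · rcases bvec_apply_cases o v 1 with ⟨h1', -⟩ | ⟨-, e1 | e1⟩
      · exact absurd h1 h1'
      · omega
      · omega

/-- The `21`-condition on shape `B` coincides with the `22`-condition (`y₁ + y₂ = 2 + 0` automatically). -/
theorem third21_bvec_iff (o : Fin 759) (v : ℕ) :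
    ((bvec o v) 0 + (bvec o v) 1 = 4 ∧ (bvec o v) 0 + (bvec o v) 2 = 2 ∧ (bvec o v) 1 + (bvec o v) 2 = 2) ↔
      ((0 : Fin 24) ∈ osupp o ∧ (1 : Fin 24) ∈ osupp o ∧ (2 : Fin 24) ∉ osupp o) ∧
        (v.testBit 0 = false ∧ v.testBit 1 = false) := by
  rw [← third22_bvec_iff]
  constructor
  · rintro ⟨h01, h02, -⟩
    exact ⟨h01, h02⟩
  · rintro ⟨h01, h02⟩
    refine ⟨h01, h02, ?_⟩
    rcases bvec_apply_cases o v 0 with ⟨-, e0⟩ | ⟨-, e0 | e0⟩ <;>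
      rcases bvec_apply_cases o v 1 with ⟨-, e1⟩ | ⟨-, e1 | e1⟩ <;> omega

set_option maxRecDepth 100000 in
/-- `77 - 21 = 56` octads contain `0, 1` and avoid `2`. -/
theorem card_octads_01_not2 :
    (univ.filter fun o : Fin 759 => (0 : Fin 24) ∈ osupp o ∧ (1 : Fin 24) ∈ osupp o ∧ (2 : Fin 24) ∉ osupp o).card = 56 := by
  decide +kernel

/-- `56 · 32 = 1792` shape-`B` vectors satisfy the `22`-condition, and the same ones the `21`-condition. -/
theorem card_thirdB :
    ((univ ×ˢ range 128).filter fun p : Fin 759 × ℕ =>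
      (bvec p.1 p.2) 0 + (bvec p.1 p.2) 1 = 4 ∧ (bvec p.1 p.2) 0 + (bvec p.1 p.2) 2 = 2).card = 1792 ∧
    ((univ ×ˢ range 128).filter fun p : Fin 759 × ℕ =>
      (bvec p.1 p.2) 0 + (bvec p.1 p.2) 1 = 4 ∧ (bvec p.1 p.2) 0 + (bvec p.1 p.2) 2 = 2 ∧
        (bvec p.1 p.2) 1 + (bvec p.1 p.2) 2 = 2).card = 1792 := by
  have key : ((univ ×ˢ range 128).filter fun p : Fin 759 × ℕ =>
      ((0 : Fin 24) ∈ osupp p.1 ∧ (1 : Fin 24) ∈ osupp p.1 ∧ (2 : Fin 24) ∉ osupp p.1) ∧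
        (p.2.testBit 0 = false ∧ p.2.testBit 1 = false)).card = 1792 := by
    rw [Finset.filter_product (fun o : Fin 759 => (0 : Fin 24) ∈ osupp o ∧ (1 : Fin 24) ∈ osupp o ∧ (2 : Fin 24) ∉ osupp o)
        (fun v : ℕ => v.testBit 0 = false ∧ v.testBit 1 = false),
      card_product, card_octads_01_not2, card_patterns_00]
  refine ⟨?_, ?_⟩
  · rw [Finset.filter_congr (fun p _ => third22_bvec_iff p.1 p.2), key]
  · rw [Finset.filter_congr (fun p _ => third21_bvec_iff p.1 p.2), key]

/-! ### Shape `A` (none: `y₀ + y₂ = 2` is impossible with entries in `{0, ±4}`) and the totals -/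

set_option maxRecDepth 100000 in
/-- No shape-`A` vector satisfies either condition. -/
theorem card_thirdA :
    (idxA.filter fun p => (avec p.1.1 p.1.2 p.2.1 p.2.2) 0 + (avec p.1.1 p.1.2 p.2.1 p.2.2) 1 = 4 ∧
      (avec p.1.1 p.1.2 p.2.1 p.2.2) 0 + (avec p.1.1 p.1.2 p.2.1 p.2.2) 2 = 2).card = 0 ∧
    (idxA.filter fun p => (avec p.1.1 p.1.2 p.2.1 p.2.2) 0 + (avec p.1.1 p.1.2 p.2.1 p.2.2) 1 = 4 ∧
      (avec p.1.1 p.1.2 p.2.1 p.2.2) 0 + (avec p.1.1 p.1.2 p.2.1 p.2.2) 2 = 2 ∧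
      (avec p.1.1 p.1.2 p.2.1 p.2.2) 1 + (avec p.1.1 p.1.2 p.2.1 p.2.2) 2 = 2).card = 0 := by
  rw [idxA]
  refine ⟨?_, ?_⟩ <;> decide +kernel

/-- **`|third22| = 2816`** (`= A₀(u)` of the `(23, 4600, 1/3)` code). [cite: ConwaySloane1999, Ch. 14 Theorem 24 (e)] -/
theorem card_third22 : third22.card = 2816 := by
  rw [third22, card_filter_leechInt (fun y => y 0 + y 1 = 4 ∧ y 0 + y 2 = 2) card_thirdA.1 card_thirdB.1 card_thirdC.1]

/-- **`|third21| = 1792`.** [cite: ConwaySloane1999, Ch. 4 §11 (135)] -/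
theorem card_third21 : third21.card = 1792 := by
  rw [third21, card_filter_leechInt (fun y => y 0 + y 1 = 4 ∧ y 0 + y 2 = 2 ∧ y 1 + y 2 = 2) card_thirdA.2 card_thirdB.2
    card_thirdC.2]

/-! ### Members, and the projected configurations inside `pre4600` -/

/-- Members of `third22`. -/
theorem mem_third22 {y : Fin 24 → ℤ} (hy : y ∈ third22) : y ∈ leechInt ∧ (y 0 + y 1 = 4 ∧ y 0 + y 2 = 2) := by
  rw [third22] at hy; simpa using hy

/-- Members of `third21`. -/
theorem mem_third21 {y : Fin 24 → ℤ} (hy : y ∈ third21) :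
    y ∈ leechInt ∧ (y 0 + y 1 = 4 ∧ y 0 + y 2 = 2 ∧ y 1 + y 2 = 2) := by
  rw [third21] at hy; simpa using hy

/-- `third22 ⊆ nbr` (its members are neighbours of `x₀`). -/
theorem third22_subset_nbr : third22 ⊆ nbr := by
  intro y hy
  obtain ⟨hL, h01, -⟩ := mem_third22 hy
  rw [nbr, mem_filter, ip_x0]
  exact ⟨hL, by omega⟩

/-- `third21 ⊆ third22`. -/
theorem third21_subset_third22 : third21 ⊆ third22 := by
  intro y hy
  obtain ⟨hL, h01, h02, -⟩ := mem_third21 hy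
  rw [third22, mem_filter]
  exact ⟨hL, h01, h02⟩

/-- The projected, normalised `22`-section (in `ℝ²⁴`). -/
noncomputable def pre22 : Finset (EuclideanSpace ℝ (Fin 24)) := third22.image fun y => toE 96 (proj y)

/-- The projected, normalised `21`-section (in `ℝ²⁴`). -/
noncomputable def pre21 : Finset (EuclideanSpace ℝ (Fin 24)) := third21.image fun y => toE 96 (proj y)

/-- `pre22 ⊆ pre4600`. -/
theorem pre22_subset : pre22 ⊆ pre4600 := image_subset_image third22_subset_nbr

/-- `pre21 ⊆ pre22`. -/
theorem pre21_subset : pre21 ⊆ pre22 := image_subset_image third21_subset_third22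

/-- `|pre22| = 2816`. -/
theorem card_pre22 : pre22.card = 2816 := by
  rw [pre22, card_image_of_injOn (fun y _ y' _ h => proj_injective (toE_injective (by norm_num) h)), card_third22]

/-- `|pre21| = 1792`. -/
theorem card_pre21 : pre21.card = 1792 := by
  rw [pre21, card_image_of_injOn (fun y _ y' _ h => proj_injective (toE_injective (by norm_num) h)), card_third21]

/-! ### Normals and the transfer to `ℝ²²`, `ℝ²¹` -/

/-- `(-4,4,4,0,…)`: with `x₀, w₂₂` an orthogonal basis of `⟨x₀, x₀₂, x₁₂⟩`. -/
def w21t : Fin 24 → ℤ := fun j => if j = 0 then -4 else if j = 1 then 4 else if j = 2 then 4 else 0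

/-- Testing against `w21t`. -/
theorem ip_w21t (y : Fin 24 → ℤ) : ip w21t y = -4 * y 0 + 4 * y 1 + 4 * y 2 := by
  simp [ip, w21t, Fin.sum_univ_succ]; ring

/-- `toE 96 w ≠ 0` for an integer vector of positive norm. -/
theorem toE96_ne_zero {w : Fin 24 → ℤ} (h : 0 < ip w w) : toE 96 w ≠ 0 := by
  intro h0
  have hi := inner_toE (q := 96) (by norm_num) w w
  rw [h0, inner_zero_left] at hi
  have : (0 : ℝ) < (ip w w : ℝ) / 96 := by positivity
  linarith

/-- Orthogonality through `toE 96`. -/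
theorem inner_toE96_eq_zero {w w' : Fin 24 → ℤ} (h : ip w w' = 0) : inner ℝ (toE 96 w) (toE 96 w') = 0 := by
  rw [inner_toE (by norm_num), h]; simp

/-- The projections of `third22` are orthogonal to `x₀` and `w₂₂`. -/
theorem orth_pre22 : ∀ x ∈ pre22, ∀ i, inner ℝ ((![toE 96 x0, toE 96 w22] : Fin 2 → _) i) x = 0 := by
  intro x hx i
  obtain ⟨y, hy, rfl⟩ := mem_image.mp hx
  obtain ⟨_, h01, h02⟩ := mem_third22 hy
  fin_cases i
  · exact inner_toE96_eq_zero (by rw [ip_x0_proj, ip_x0, ip_x0_x0]; omega)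
  · refine inner_toE96_eq_zero ?_
    rw [ip_w22]
    simp only [proj, x0, avec]
    simp
    omega

/-- The projections of `third21` are orthogonal to `x₀`, `w₂₂` and `w21t`. -/
theorem orth_pre21 : ∀ x ∈ pre21, ∀ i, inner ℝ ((![toE 96 x0, toE 96 w22, toE 96 w21t] : Fin 3 → _) i) x = 0 := by
  intro x hx i
  obtain ⟨y, hy, rfl⟩ := mem_image.mp hx
  obtain ⟨_, h01, h02, h12⟩ := mem_third21 hy
  fin_cases i
  · exact inner_toE96_eq_zero (by rw [ip_x0_proj, ip_x0, ip_x0_x0]; omega)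
  · refine inner_toE96_eq_zero ?_
    rw [ip_w22]
    simp only [proj, x0, avec]
    simp
    omega
  · refine inner_toE96_eq_zero ?_
    rw [ip_w21t]
    simp only [proj, x0, avec]
    simp
    omega

/-- `x₀, w₂₂` are linearly independent in `ℝ²⁴`. -/
theorem linearIndependent_two : LinearIndependent ℝ (![toE 96 x0, toE 96 w22] : Fin 2 → EuclideanSpace ℝ (Fin 24)) := by
  apply linearIndependent_of_ne_zero_of_inner_eq_zero
  · intro i
    fin_cases i
    · exact toE96_ne_zero (by rw [ip_x0_x0]; norm_num)
    · exact toE96_ne_zero (by decide)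
  · intro i j hij
    fin_cases i <;> fin_cases j
    · exact absurd rfl hij
    · exact inner_toE96_eq_zero (by decide)
    · exact inner_toE96_eq_zero (by decide)
    · exact absurd rfl hij

/-- `x₀, w₂₂, w21t` are linearly independent in `ℝ²⁴`. -/
theorem linearIndependent_three :
    LinearIndependent ℝ (![toE 96 x0, toE 96 w22, toE 96 w21t] : Fin 3 → EuclideanSpace ℝ (Fin 24)) := by
  apply linearIndependent_of_ne_zero_of_inner_eq_zero
  · intro i
    fin_cases i
    · exact toE96_ne_zero (by rw [ip_x0_x0]; norm_num)
    · exact toE96_ne_zero (by decide)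
    · exact toE96_ne_zero (by decide)
  · intro i j hij
    fin_cases i <;> fin_cases j
    · exact absurd rfl hij
    · exact inner_toE96_eq_zero (by decide)
    · exact inner_toE96_eq_zero (by decide)
    · exact inner_toE96_eq_zero (by decide)
    · exact absurd rfl hij
    · exact inner_toE96_eq_zero (by decide)
    · exact inner_toE96_eq_zero (by decide)
    · exact inner_toE96_eq_zero (by decide)
    · exact absurd rfl hij

/-- **Attained: `A(22, arccos 1/3) ≥ 2816`** — `2816` unit vectors of `ℝ²²` with pairwise inner products `≤ 1/3`
(the Leech minimal vectors `y` with `x₀·y = 16`, `x₀₂·y = 8`, projected to `⟨x₀, x₀₂⟩^⊥`).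
[cite: ConwaySloane1999, Ch. 4 §11 (135)] -/
theorem exists_code_dim22_third_2816 : ∃ C : Finset (EuclideanSpace ℝ (Fin 22)),
    C.card = 2816 ∧ (∀ x ∈ C, ‖x‖ = 1) ∧ (∀ x ∈ C, ∀ y ∈ C, x ≠ y → inner ℝ x y ≤ 1 / 3) := by
  obtain ⟨C', hc, hn, hi, _⟩ := exists_transfer_orthogonal (m := 24) (n := 22) (k := 2) rfl _
    linearIndependent_two pre22 orth_pre22
  refine ⟨C', by rw [hc, card_pre22], fun x' hx' => ?_, fun x' hx' y' hy' hne => ?_⟩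
  · obtain ⟨x, hx, he⟩ := hn x' hx'
    rw [he]; exact norm_pre4600 x (pre22_subset hx)
  · obtain ⟨x, hx, y, hy, hxy, he⟩ := hi x' hx' y' hy' hne
    rw [he]; exact inner_pre4600 x (pre22_subset hx) y (pre22_subset hy) hxy

/-- **Attained: `A(21, arccos 1/3) ≥ 1792`** — `1792` unit vectors of `ℝ²¹` with pairwise inner products `≤ 1/3`
(the Leech minimal vectors `y` with `x₀·y = 16`, `x₀₂·y = x₁₂·y = 8`, projected to `⟨x₀, x₀₂, x₁₂⟩^⊥`).
[cite: ConwaySloane1999, Ch. 4 §11 (135)] -/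
theorem exists_code_dim21_third_1792 : ∃ C : Finset (EuclideanSpace ℝ (Fin 21)),
    C.card = 1792 ∧ (∀ x ∈ C, ‖x‖ = 1) ∧ (∀ x ∈ C, ∀ y ∈ C, x ≠ y → inner ℝ x y ≤ 1 / 3) := by
  obtain ⟨C', hc, hn, hi, _⟩ := exists_transfer_orthogonal (m := 24) (n := 21) (k := 3) rfl _
    linearIndependent_three pre21 orth_pre21
  refine ⟨C', by rw [hc, card_pre21], fun x' hx' => ?_, fun x' hx' y' hy' hne => ?_⟩
  · obtain ⟨x, hx, he⟩ := hn x' hx'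
    rw [he]; exact norm_pre4600 x (pre22_subset (pre21_subset hx))
  · obtain ⟨x, hx, y, hy, hxy, he⟩ := hi x' hx' y' hy' hne
    rw [he]; exact inner_pre4600 x (pre22_subset (pre21_subset hx)) y (pre22_subset (pre21_subset hy)) hxy

/-! ### Sphere language (SPLAG Ch. 14 Thm 1 converse, `k = 1`: two touching unit spheres) -/

/-- **`ℝ²³`, two touching unit spheres: at least `2816`** further unit spheres with pairwise disjoint interiors touch
both (from `A(22, arccos 1/3) ≥ 2816` by `SphericalCodes.exists_touching_of_code`). [cite: ConwaySloane1999, Ch. 14 Theorem 1] -/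
theorem exists_touching_two_dim23_2816 : ∃ a : Fin 2 → EuclideanSpace ℝ (Fin 23), (∀ i j, i ≠ j → ‖a i - a j‖ = 2) ∧
    ∃ S : Finset (EuclideanSpace ℝ (Fin 23)), S.card = 2816 ∧ (∀ c ∈ S, ∀ i, ‖c - a i‖ = 2) ∧
      (∀ c ∈ S, ∀ c' ∈ S, c ≠ c' → 2 ≤ ‖c - c'‖) := by
  obtain ⟨C, hc, h1, h2⟩ := exists_code_dim22_third_2816
  obtain ⟨a, ha, S, hS, hS1, hS2⟩ := SphericalCodes.exists_touching_of_code (k := 1) C h1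
    (fun x hx y hy hxy => (h2 x hx y hy hxy).trans_eq (by norm_num))
  exact ⟨a, ha, S, hS.trans hc, hS1, hS2⟩

/-- **`ℝ²²`, two touching unit spheres: at least `1792`** further unit spheres with pairwise disjoint interiors touch
both (from `A(21, arccos 1/3) ≥ 1792`). [cite: ConwaySloane1999, Ch. 14 Theorem 1] -/
theorem exists_touching_two_dim22_1792 : ∃ a : Fin 2 → EuclideanSpace ℝ (Fin 22), (∀ i j, i ≠ j → ‖a i - a j‖ = 2) ∧
    ∃ S : Finset (EuclideanSpace ℝ (Fin 22)), S.card = 1792 ∧ (∀ c ∈ S, ∀ i, ‖c - a i‖ = 2) ∧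
      (∀ c ∈ S, ∀ c' ∈ S, c ≠ c' → 2 ≤ ‖c - c'‖) := by
  obtain ⟨C, hc, h1, h2⟩ := exists_code_dim21_third_1792
  obtain ⟨a, ha, S, hS, hS1, hS2⟩ := SphericalCodes.exists_touching_of_code (k := 1) C h1
    (fun x hx y hy hxy => (h2 x hx y hy hxy).trans_eq (by norm_num))
  exact ⟨a, ha, S, hS.trans hc, hS1, hS2⟩

end Summit.Ventures.PackingBounds.Config.Leech
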